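/-
Copyright: statement-level skeleton of a published paper (lit-balaban cell, Phase-2 proof seat p37 gen 90). No claims beyond
what the kernel checks below.
-/
import Mathlib
import Literature.MathematicalPhysics.QuantumFieldTheory.Balaban1983to89.B3Eq37Pictures

/-!
# B3 — T. Bałaban, *(Higgs)₂,₃ quantum fields in a finite volume. III. Renormalization*, CMP **88** (1983) 411–445
[Balaban1983Higgs3] — p. 442 [PDF 32]: the PICTURE EQUATION **(3.32)** (the graphical form of the split **(3.31)** of a degree-0
vector self-energy graph into a convergent Hölder-decorated term and a local two-leg vertex) AS DRAWN OBJECTS of the concrete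
graph model (`B3Cor23Concrete.Graph`, line kinds visible; p26's pictures-with-localized-legs `B3Eq37Pictures.LocPicture`), the
COUNT DATUM of the three drawn objects, and the DICTIONARY from the drawn objects to the three terms of r15's PROVED identity
(3.31) `B3Sect3VectorSelfEnergy.eq331`; with the drawn graph (3.25)₁ (p18's `g325a`) as the worked instance of the blob

statement-level skeleton of published theorems with citation tags; proofs where landed; nothing here is a claim about
the Yang–Mills mass gap

PDF held: `paper:balaban1983-higgs-2-3-quantum-fields-finite-volume` (journal page = PDF page + 410); pp. 417, 439, 440, 442
[PDF 7, 29, 30, 32] read in the OCR text (`p0030.txt`–`p0032.txt`) and on the ×2 render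
`run/shared/lean/pub/pub-balaban/b2b-balaban-ref1/pages/1983-cmp88-higgs23-III/1983-cmp88-higgs23-III-p032-x2.png` (the pictures
(3.30) and (3.32), re-read by this seat 2026-08-23).

CITATION HEADER (lean-in-tree rule).  lit-balaban TYPED SKELETON (HOME `run/shared/lean/pub/lit-balaban/`), PHASE 2, seat p37 gen 90
(unit `lit-balaban-p37-g90`; TAKING line HOME/STATUS.md 2026-08-23T02:13:08Z), free target named by the fold owner r15 g14
(`B3-CLOSURE.md` v1.21 §5 item 15 (ε), OWNER RULING 2026-08-23T02:10:35Z, p32 g30's yield 02:16:30Z): *"(ε) the (3.32) picture pair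
as drawn objects with count datum + dictionary to `eq331`'s two terms (Q1 standard; p26/p18 vocabulary)"* — the Q1 standard being
lead g10's head-word criterion of 2026-08-22T21:19:00Z as served by p26 g33's `B3Eq37Pictures` (pictures typed as model graphs with
line kinds visible and the localization of p. 417, count datum DERIVED from the drawn object, explicit dictionary lemmas to the
typed expressions).  ROW **B3.Eq3.25-3.32** of `HOME/lit-balaban-r15/ROWS-B3.md` (fold owner r15, referee ref-4).  CONSUMES BY
NAME: p26 gen 33's `B3Eq37Pictures.LocPicture`/`LocPicture.natural`/`kind36`/`sLeg`/`vLeg`/`legDiffs`/`legAvg`/`legDiffs36`/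
`LineEnum`/`countsOf` (p-format), p18 gen 3's drawn graph (3.25)₁ `B3Sect3LowestOrderGraphs.g325a` (`g325a_deg`) on the model
`B3Cor23Concrete.Graph` (`Leg`, `other`, `deg`), this cell's count datum `B3Eq330Members.graph325a` (= `bubble δ325a`;
`degQ_one_graph325a`, `degQ_two_graph325a`), r15's (3.26)/(3.31) carrier `B3Sect3VectorSelfEnergy` (`pairSum`, `legFar`, `legNear`,
`pairSum_local`, `kerA`, **`eq331`**).

THE PRINTED TEXT (verbatim).  p. 442 [PDF 32]: *"The other primitively divergent graphs are considered in a simpler way, because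
they have degree 0. We write
Σ_{x,x′} η^{2d} Σ_{μ,μ′=1}^d g(x)A_μ(x)Π_{μμ′}(x,x′)g′(x′)A′_{μ′}(x′)
= Σ_{x,x′} η^{2d} Σ_{μ,μ′=1}^d g(x)A_μ(x)Π_{μμ′}(x,x′)|x′−x|^α (g′(x′)A′_{μ′}(x′) − g′(x)A′_{μ′}(x))/|x′−x|^α
+ Σ_x η^d Σ_{μ,μ′=1}^d g(x)A_μ(x)(Σ_{x′}η^dΠ_{μμ′}(x,x′))g′(x)A′_{μ′}(x), (3.31)
and the first term on the right side is convergent. To the second term we apply the same transformations as previously, i.e. we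
rescale it from the η-lattice to the L^{−j₀}-lattice, we resum over proper orderings and j-indices, we replace the propagators
G_{j₀}(0), G_{j₀} by C^ξ and finally to the expressions containing the propagators C^ξ only we apply a proper Ward-Takahashi
identity. This gives us that the second term is convergent and we can represent graphically the equality (3.31) in the form
[∿◯∿] = [∿(◯ +α)∿ with the arrowhead −α on the second external leg] + [∿×∿] (3.32)
We have to remark that if the subgraph (2.4) appears in the first term on the right side above and at least one of the vertices
of this subgraph is different from the vertices with external legs, then we apply the integration by parts formula (2.8) to this
vertex. If both vertices have external legs, then the factor |x′−x|^α renders the integration by parts unnecessary."*; p. 440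
[PDF 30] on the analogous decoration at order 1+α (the pictures (3.30) carry "+(1+α)" in the blob and "−(1+α)" on the arrowed leg):
*"The expressions in the last curly bracket above are the generalized expressions of the same form as in (3.11), they have positive
degree −d+3+α"*; p. 439 [PDF 29]: *"The graphs of lowest order are [four pictures] (D = −d + 2), (3.25)"*; p. 417 [PDF 7]: *"δm²_G …
will be represented by the same graph G but with both external legs localized in x and with the summation over x′."*; p. 415
legend (1.17): wavy line = A′, arrowhead = differentiation.
READING OF THE PICTURES (p. 442 render).  LHS of (3.32) = a blob (an arbitrary vector self-energy graph of degree 0: *"the other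
primitively divergent graphs"*) with its two external A′-legs (wavy), the leg g(x)A_μ(x) at the vertex x and the leg g′(x′)A′_{μ′}(x′)
at the vertex x′ — the left side of (3.31) with Π_{μμ′}(x,x′) the kernel of the blob; RHS₁ = the same blob inscribed "+α" (the
weight |x′−x|^α multiplying the kernel) whose second external leg carries the arrowhead "−α" (the difference quotient
(g′(x′)A′_{μ′}(x′) − g′(x)A′_{μ′}(x))/|x′−x|^α relative to the other external vertex x) — the first term of (3.31); RHS₂ = the local
two-leg vertex ∿×∿: by p. 417 the same graph with BOTH external legs localized in x and the summation over x′ performed, i.e. the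
quadratic form Σ_xη^dΣ_{μμ′}g(x)A_μ(x)·c_{μμ′}(x)·g′(x)A′_{μ′}(x) with the coefficient c_{μμ′}(x) = Σ_{x′}η^dΠ_{μμ′}(x,x′) — the second
term of (3.31).

WHAT IS TYPED / PROVED (definitions with bodies + theorems; no `Prop` fact, no `sorry`; standard axioms).
§1 DRAWN OBJECTS.  **`VBlob`**: a graph of p18's model with two chosen EXTERNAL A′-legs `e` (the leg of A_μ, vertex x = `e.1`) and
`e′` (the leg of A′_{μ′}, vertex x′ = `e′.1`) at distinct vertices and no other external leg — the blob of (3.32) (and of (3.30));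
**`VBlob.blob`** (LHS: natural localization), **`VBlob.vertex`** (RHS₂ = ∿×∿: the same graph with both external legs localized at x,
`VBlob.locAt` — p26's `loc37` for an arbitrary blob), **`HolderPicture`** (a localized picture DECORATED with an exponent `α` written
into the blob and one external leg `wleg` carrying the order-α difference quotient relative to a base vertex — the drawn
convention of (3.12)/(3.22)/(3.30)/(3.32)), **`VBlob.holder α`** (RHS₁), **`PicEq332`/`pic332`** = (3.32) as the triple (LHS, RHS₁,
RHS₂); kernel facts `vertex_loc_e`/`vertex_loc_e'` (both external legs at x), `vertex_loc_int`, `vertex_ne_blob`, `holder_data`;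
the INSTANCE **`blob325a`** = p18's drawn (3.25)₁ `g325a` (two vertices (1.8)_{1,0} = p26's `kind36`; closed form of its lines
`other325` with `g325a_other`; both lines are φ′-lines, each through ONE differentiated leg, at opposite vertices: `g325a_lines`,
`enum325a_kinds`; the external legs are exactly the two wavy legs: `other325_eq_none_iff`).
§2 COUNT DATA.  `HolderPicture.deg d` := D(G) + α (the printed rule: the weight |x′−x|^{κ} in the blob raises the degree by κ —
p. 440 "positive degree −d+3+α" = (−d+2) + (1+α)); **`deg_holder_pos_of_degZero`**: D(G) = 0 ∧ α > 0 ⇒ the decorated picture RHS₁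
has degree α > 0 (*"the first term on the right side is convergent"*; the analytic content of "degree 0 & Σκ = α > 0 ⇒ Prop. 2.2
applies" is p18 g8's `B3Eq320PositiveSubgraphs.posSubgraphsExcept24_of_degZero`, cited not restated); **`deg_holder_blob325a`**:
the (3.30)-decoration "+(1+α)" of (3.25)₁ has degree −d+3+α (print's number, from p18's `g325a_deg`); `g325a_degZero_iff`: (3.25)₁
is a degree-0 blob exactly in d = 2 (in d = 3 it is the D = −1 case treated by (3.26)–(3.30), NOT a (3.31) graph — honest scope);
the p19 count datum of the instance DERIVED from the drawn graph: `enum325a` (p26's `LineEnum`), **`countsOf_g325a : countsOf (g325a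
n̄ hn) (enum325a hn) 3 2 1 ⋯ = graph325a`** (this cell's `B3Eq330Members` datum IS the one read off p18's drawing),
`degQ_one_countsOf_g325a` (each one-line block has degree 1), `degQ_two_countsOf_g325a` ("(D = −d + 2)": −1 at d = 3, = p18's
catalogue degree).
§3 DICTIONARY.  **`ampV`**: the expression of a localized picture with two chosen external VECTOR legs — Σ over all vertex
positions xs of η^{(#vertices)d}Σ_{μμ′} g(xs(loc e))A_μ(xs(loc e))·K(xs)_{μμ′}·g′(xs(loc e′))A′_{μ′}(xs(loc e′)) (each leg's field AT
ITS LOCALIZATION VERTEX, p. 417; p26's `LocPicture.amp` for vector legs); **`ampH`**: the same for a Hölder-decorated picture, the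
decorated leg reading |xs(base) − xs(loc wleg)|^α·(g′A′_{μ′}(xs(loc wleg)) − g′A′_{μ′}(xs(base)))/|…|^α (|x′−x| = η·`supDist` as in
r15's `eq331`); **`VBlob.redKernel`** = Π_{μμ′}(x,x′): the blob's kernel summed over the positions of its INTERNAL vertices with
the two external vertices pinned at x, x′ (weight η^{(#vertices−2)d}); **`VBlob.vertexCoeff`** = c_{μμ′}(x) = Σ_{x′}η^dΠ_{μμ′}(x,x′);
the master lemma `VBlob.sum_pair` (pinning the external vertices turns the all-positions sum into r15's `pairSum` with the reduced
kernel) and the three readings **`ampV_blob`** (LHS = `pairSum η Π g A (legFar g′ A′)`, the left side of (3.31)), **`ampH_holder`**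
(RHS₁ = the first term of (3.31)), **`ampV_vertex`**/**`ampV_vertex_resummed`** (RHS₂ = `pairSum η Π g A (legNear g′ A′)` = the
second term of (3.31), *"with the summation over x′"*, r15's `pairSum_local`), and **`eq332 : ampV B.blob … = ampH (B.holder α) … +
ampV B.vertex …`** (η > 0, every real α, every kernel) — r15's PROVED `eq331` BY NAME: the picture equation (3.32) IS the identity
(3.31) through the dictionary.  Instance: `redKernel_blob325a` (two vertices: Π = the supplied two-point kernel), **`amp_g325a_T1`**:
the drawn (3.25)₁ with r15's kernel `kerA` of its two lines reads as the first graph term T₁ of (3.26) (`pairSum η kerA g A (legFar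
g′ A′)`, cf. `lhs326`) and its p. 417-localization as the first term of the square bracket (`legNear`, cf. `bracket326`).
HONEST SCOPE.  (i) As in `B3Eq37Pictures`: the localization datum, the decoration datum and `ampV`/`ampH` are this file's READING of
pp. 417/442 on top of p18's model, which has no amplitude map of its own; the kernel K(xs) (product of the propagators of the
blob's lines and its vertex factors) is supplied by the caller — a dictionary for the pictures of Sect. 3, not a Feynman-rule
evaluator.  (ii) "Degree 0" is a HYPOTHESIS on the blob (`Graph.deg`), as printed ("the other primitively divergent graphs");
no specific degree-0 graph of d = 3 is drawn in print and none is invented here; the instance (3.25)₁ inhabits `VBlob` and is a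
degree-0 blob only in d = 2 (`g325a_degZero_iff`).  (iii) `HolderPicture`/`ampH` type the order-α decoration of (3.32); the
order-(1+α) pictures of (3.30) are the same DRAWN structure (`deg_holder_blob325a`) but their expressions carry the Taylor
remainder of (3.10) (r15's `curly2`, p32's (δ) `B3Ineq326LastBracket`), not `ampH`.  (iv) Nothing analytic is added: the
convergence of RHS₁ (Prop. 2.2 route) and of RHS₂ (rescaling, resummation, Ward–Takahashi) are rows B3.Prop2.2 / B3.Eq2.26-2.28
and the cells of p39 (F3) / p32 (δ); (3.31) itself is r15's theorem.  (v) d = 3, L = 2, δ₁ = 1 in the derived count datum, as in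
`B3Eq330Members`.
Unit `lit-balaban-p37-g90` (literature-prover-lit-balaban-p37-g90-0), HOME `run/shared/lean/pub/lit-balaban/`, 2026-08-23.
-/

open Finset

namespace Literature.MathematicalPhysics.QuantumFieldTheory.Balaban1983to89.B3Eq332Pictures

/-! ## §1 The drawn objects of (3.32): the blob, the decorated blob, the local vertex -/

section Pictures

open B3Prop1 B3Cor23Concrete B3Sect3LowestOrderGraphs B3Eq37Pictures

variable {nbar : ℕ}

/-- **The blob of (3.32)** p. 442 [PDF 32] (*"The other primitively divergent graphs … have degree 0"* — vector self-energy graphs):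
a graph of p18's model with two chosen EXTERNAL A′-legs, `e` (the leg of g(x)A_μ(x), at the vertex x = `e.1`) and `e′` (the leg of
g′(x′)A′_{μ′}(x′), at the vertex x′ = `e′.1` ≠ x), and no other external leg. [cite: Balaban1983Higgs3, (3.32) p.442] -/
structure VBlob (nbar : ℕ) where
  /-- the drawn graph inside the blob -/
  G : Graph nbar
  /-- the external leg of A_μ (vertex x) -/
  e : Leg G.kind
  /-- the external leg of A′_{μ′} (vertex x′) -/
  e' : Leg G.kind
  /-- `e` is an A′-leg (wavy) -/
  vec : e.2.isLeft = false
  /-- `e′` is an A′-leg (wavy) -/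
  vec' : e'.2.isLeft = false
  /-- `e` is external -/
  ext : G.other e = none
  /-- `e′` is external -/
  ext' : G.other e' = none
  /-- the two external legs sit at distinct vertices x ≠ x′ -/
  ne : e.1 ≠ e'.1
  /-- there is no other external leg (a self-energy graph for vector fields) -/
  only : ∀ x, G.other x = none → x = e ∨ x = e'

/-- A blob has at least the two vertices x, x′. [cite: Balaban1983Higgs3, (3.32) p.442] -/
theorem VBlob.two_le_nV (B : VBlob nbar) : 2 ≤ B.G.nV := by
  have h : Nontrivial (Fin B.G.nV) := ⟨⟨B.e.1, B.e'.1, B.ne⟩⟩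
  have h1 := Fintype.one_lt_card_iff_nontrivial.2 h
  rwa [Fintype.card_fin] at h1

/-- **LHS of (3.32)**: the blob with its two wavy legs, each external leg at its own vertex (natural localization; the left side
of (3.31)). [cite: Balaban1983Higgs3, (3.32) p.442] -/
def VBlob.blob (B : VBlob nbar) : LocPicture nbar := LocPicture.natural B.G

/-- The localization of the local vertex ∿×∿ in closed form (p. 417; p26's `loc37` for an arbitrary blob): a leg on an internal
line stays at its vertex, an external leg goes to x = `e.1`. [cite: Balaban1983Higgs3, p.417] -/
def VBlob.locAt (B : VBlob nbar) : Leg B.G.kind → Fin B.G.nV := fun x => if (B.G.other x).isSome then x.1 else B.e.1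

/-- **RHS₂ of (3.32), the local two-leg vertex ∿×∿**: by p. 417 *"the same graph G but with both external legs localized in x and
with the summation over x′"* — the blob with BOTH external A′-legs localized at x (the second term of (3.31)).
[cite: Balaban1983Higgs3, (3.32) p.442] -/
def VBlob.vertex (B : VBlob nbar) : LocPicture nbar where
  G := B.G
  loc := B.locAt
  loc_int x hx := by simp only [VBlob.locAt, hx, if_true]

/-- **A Hölder-DECORATED picture** (the drawn convention of (3.12), (3.22), (3.30), (3.32)): a localized picture whose blob is
inscribed with an exponent "+α" (the weight |x′−x|^α multiplying its kernel) and one of whose external legs `wleg` carries the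
arrowhead "−α" (the difference quotient of order α of its field, relative to the vertex `base`).
[cite: Balaban1983Higgs3, (3.32) p.442] -/
structure HolderPicture (nbar : ℕ) extends LocPicture nbar where
  /-- the exponent written into the blob -/
  α : ℝ
  /-- the external leg carrying the difference quotient ("−α") -/
  wleg : Leg G.kind
  /-- the vertex relative to which the difference is taken -/
  base : Fin G.nV
  /-- the decorated leg is external -/
  wleg_ext : G.other wleg = none

/-- **RHS₁ of (3.32)**: the blob inscribed "+α", its leg `e′` (of A′_{μ′}, at x′) carrying "−α" relative to x (the first term of
(3.31): Π_{μμ′}(x,x′)|x′−x|^α · (g′(x′)A′_{μ′}(x′) − g′(x)A′_{μ′}(x))/|x′−x|^α). [cite: Balaban1983Higgs3, (3.32) p.442] -/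
def VBlob.holder (B : VBlob nbar) (α : ℝ) : HolderPicture nbar where
  toLocPicture := B.blob
  α := α
  wleg := B.e'
  base := B.e.1
  wleg_ext := B.ext'

/-- A picture equation [LHS] = [decorated term] + [local term], as printed in (3.32) (the model has no algebra of pictures; the
three drawn objects are recorded in order). [cite: Balaban1983Higgs3, (3.32) p.442] -/
structure PicEq332 (nbar : ℕ) where
  /-- the left side -/
  lhs : LocPicture nbar
  /-- the first (convergent, decorated) term of the right side -/
  holderTerm : HolderPicture nbar
  /-- the second (local vertex) term of the right side -/
  localTerm : LocPicture nbar

/-- **(3.32)** p. 442 [PDF 32]: [∿◯∿] = [∿(◯ +α)∿, arrowhead −α] + [∿×∿], for the blob `B` and the exponent `α`.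
[cite: Balaban1983Higgs3, (3.32) p.442] -/
def pic332 (B : VBlob nbar) (α : ℝ) : PicEq332 nbar := ⟨B.blob, B.holder α, B.vertex⟩

/-- LHS: every leg at its own vertex. [cite: Balaban1983Higgs3, (3.32) p.442] -/
theorem VBlob.blob_loc (B : VBlob nbar) (x : Leg B.G.kind) : B.blob.loc x = x.1 := rfl

/-- The three pictures of (3.32) have the SAME drawn graph (p. 417 *"the same graph G"*). [cite: Balaban1983Higgs3, p.417] -/
theorem VBlob.pics_G (B : VBlob nbar) (α : ℝ) : B.blob.G = B.G ∧ B.vertex.G = B.G ∧ (B.holder α).G = B.G := ⟨rfl, rfl, rfl⟩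

/-- ∿×∿: the leg of A_μ stays at x … [cite: Balaban1983Higgs3, (3.32) p.442] -/
theorem VBlob.vertex_loc_e (B : VBlob nbar) : B.vertex.loc B.e = B.e.1 := by
  show B.locAt B.e = B.e.1
  simp [VBlob.locAt, B.ext]

/-- … and **the leg of A′_{μ′} is localized at x too** (both external legs in x). [cite: Balaban1983Higgs3, (3.32) p.442] -/
theorem VBlob.vertex_loc_e' (B : VBlob nbar) : B.vertex.loc B.e' = B.e.1 := by
  show B.locAt B.e' = B.e.1
  simp [VBlob.locAt, B.ext']

/-- … while the legs on internal lines stay where they are. [cite: Balaban1983Higgs3, p.417] -/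
theorem VBlob.vertex_loc_int (B : VBlob nbar) (x : Leg B.G.kind) (hx : (B.G.other x).isSome) : B.vertex.loc x = x.1 :=
  B.vertex.loc_int x hx

/-- ∿×∿ ≠ ∿◯∿ as localized pictures (they differ at the leg of x′). [cite: Balaban1983Higgs3, (3.32) p.442] -/
theorem VBlob.vertex_ne_blob (B : VBlob nbar) : B.vertex ≠ B.blob := by
  intro h
  have hF : ∀ x : Leg B.vertex.G.kind, (B.vertex.loc x).val = x.1.val := by
    rw [h]; intro x; rfl
  have h1 := hF B.e'
  rw [vertex_loc_e'] at h1
  exact B.ne (Fin.ext h1)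

/-- RHS₁: the same graph and localization as the LHS, exponent `α`, the decorated leg = `e′`, base vertex = x.
[cite: Balaban1983Higgs3, (3.32) p.442] -/
theorem VBlob.holder_data (B : VBlob nbar) (α : ℝ) :
    (B.holder α).toLocPicture = B.blob ∧ (B.holder α).α = α ∧ (B.holder α).wleg = B.e' ∧ (B.holder α).base = B.e.1 :=
  ⟨rfl, rfl, rfl, rfl⟩

/-- (3.32) = (LHS, RHS₁, RHS₂). [cite: Balaban1983Higgs3, (3.32) p.442] -/
theorem pic332_terms (B : VBlob nbar) (α : ℝ) :
    (pic332 B α).lhs = B.blob ∧ (pic332 B α).holderTerm = B.holder α ∧ (pic332 B α).localTerm = B.vertex := ⟨rfl, rfl, rfl⟩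

/-! ### The instance: the drawn graph (3.25)₁ (p18's `g325a`) as a blob -/

/-- The lines of (3.25)₁ in closed form (p18's `g325a.other`, verbatim): the φ′-leg `j` of the vertex `i` is joined to the φ′-leg
`1 − j` of the other vertex (two φ′-lines, each through exactly one differentiated leg), the A′-legs are external; the vertices
are p26's `kind36` (both (1.8)_{1,0}). [cite: Balaban1983Higgs3, (3.25) p.439] -/
def other325 : Leg kind36 → Option (Leg kind36)
  | ⟨i, .inl j⟩ => some ⟨i.rev, .inl ⟨1 - j.val, by show 1 - j.val < 2; omega⟩⟩
  | ⟨_, .inr _⟩ => none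

variable (hn : 1 ≤ nbar)

/-- p18's `g325a` has the vertices `kind36`, two of them, and the lines `other325` (definitionally).
[cite: Balaban1983Higgs3, (3.25) p.439] -/
theorem g325a_kind_nV : (g325a nbar hn).kind = kind36 ∧ (g325a nbar hn).nV = 2 := ⟨rfl, rfl⟩

/-- … the lines. [cite: Balaban1983Higgs3, (3.25) p.439] -/
theorem g325a_other (x : Leg kind36) : (g325a nbar hn).other x = other325 x := by
  obtain ⟨i, y⟩ := x
  rcases y with j | j <;> rfl

/-- **Line kinds of (3.25)₁**: the φ′-leg `j` of `i` is joined to the φ′-leg `1 − j` of the other vertex — so each of the two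
φ′-lines passes through exactly ONE differentiated (arrowed, `j = 0`) leg, at opposite vertices — and the two A′-legs (wavy) are
external. DECIDED on the closed form. [cite: Balaban1983Higgs3, (3.25) p.439] -/
theorem g325a_lines :
    (∀ i j : Fin 2, other325 (sLeg i j) = some (sLeg i.rev j.rev)) ∧ ∀ i : Fin 2, other325 (vLeg i) = none := by
  refine ⟨by decide, by decide⟩

/-- **The external legs of (3.25)₁ are exactly its two A′-legs**, one at each vertex. [cite: Balaban1983Higgs3, (3.25) p.439] -/
theorem other325_eq_none_iff : ∀ x : Leg kind36, other325 x = none ↔ x = vLeg 0 ∨ x = vLeg 1 := by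
  decide

/-- **(3.25)₁ as a blob**: p18's drawn graph `g325a`, the leg of A_μ = the A′-leg of the vertex `x = 0`, the leg of A′_{μ′} = the
A′-leg of `x′ = 1` (the external-leg pattern shared by all the pictures of (3.30) and (3.32)). [cite: Balaban1983Higgs3, (3.25) p.439] -/
def blob325a (hn : 1 ≤ nbar) : VBlob nbar where
  G := g325a nbar hn
  e := vLeg 0
  e' := vLeg 1
  vec := rfl
  vec' := rfl
  ext := rfl
  ext' := rfl
  ne := by show (0 : Fin 2) ≠ 1; decide
  only x hx := (other325_eq_none_iff x).1 (by rwa [g325a_other] at hx)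

/-- the data of the instance. [cite: Balaban1983Higgs3, (3.25) p.439] -/
theorem blob325a_data : (blob325a hn).G = g325a nbar hn ∧ (blob325a hn).e = vLeg 0 ∧ (blob325a hn).e' = vLeg 1 :=
  ⟨rfl, rfl, rfl⟩

/-- For (3.25)₁ the local vertex ∿×∿ puts both wavy legs at `x = 0` and leaves the four φ′-legs (all internal) in place.
[cite: Balaban1983Higgs3, (3.30) p.442] -/
theorem vertex325a_loc :
    (blob325a hn).vertex.loc (vLeg 0) = (0 : Fin 2) ∧ (blob325a hn).vertex.loc (vLeg 1) = (0 : Fin 2) ∧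
      ∀ i j : Fin 2, (blob325a hn).vertex.loc (sLeg i j) = i := by
  refine ⟨(blob325a hn).vertex_loc_e, (blob325a hn).vertex_loc_e', fun i j => ?_⟩
  refine (blob325a hn).vertex_loc_int (sLeg i j) ?_
  show ((g325a nbar hn).other (sLeg i j)).isSome
  rw [g325a_other, g325a_lines.1 i j]
  rfl

end Pictures

/-! ## §2 Count data: "degree 0", "+α", and the datum of (3.25)₁ derived from the drawing -/

section Counting

open B3Prop1 B3Cor23Concrete B3Sect3LowestOrderGraphs B3Eq37Pictures
open B3Ineq215 B3Ineq213 B3TwoVertexBlocks B3Eq312Member B3Eq330Members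

variable {nbar : ℕ}

noncomputable section

/-- **The degree of a decorated picture**: D(G) + α — the weight |x′−x|^{κ} written into a blob raises the degree of the whole
graph by κ (p. 440 on the order-(1+α) decoration of the D = −d+2 graphs (3.25): *"they have positive degree −d+3+α"*; p. 438
(3.20): *"a generalized expression of degree +α"*). [cite: Balaban1983Higgs3, (3.26) p.440] -/
def HolderPicture.deg (H : HolderPicture nbar) (d : ℕ) : ℝ := (H.G.deg d : ℝ) + H.α

/-- RHS₁ of (3.32) has degree D(blob) + α. [cite: Balaban1983Higgs3, (3.32) p.442] -/
theorem VBlob.deg_holder (B : VBlob nbar) (α : ℝ) (d : ℕ) : (B.holder α).deg d = (B.G.deg d : ℝ) + α := rfl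

/-- **"they have degree 0 … and the first term on the right side is convergent"**: for a degree-0 blob and α > 0 the decorated
picture RHS₁ has the positive degree α.  (The analytic content — every subgraph keeps positive degree and Proposition 2.2 applies
to the generalized graph — is p18 g8's `B3Eq320PositiveSubgraphs.posSubgraphsExcept24_of_degZero` (D(G) = 0, κ ≥ 0, Σκ = α > 0),
cited not restated; the p. 442 remark on an inner subgraph (2.4) is its `Except24` clause.) [cite: Balaban1983Higgs3, (3.31) p.442] -/
theorem VBlob.deg_holder_pos_of_degZero (B : VBlob nbar) {α : ℝ} {d : ℕ} (h0 : B.G.deg d = 0) (hα : 0 < α) :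
    0 < (B.holder α).deg d ∧ (B.holder α).deg d = α := by
  rw [B.deg_holder, h0, Rat.cast_zero, zero_add]
  exact ⟨hα, rfl⟩

variable (hn : 1 ≤ nbar)

/-- **p. 440's number for (3.30)**: the order-(1+α) decoration of the drawn graph (3.25)₁ (D = −d + 2, p18's `g325a_deg`) has
degree −d + 3 + α. [cite: Balaban1983Higgs3, (3.26) p.440] -/
theorem deg_holder_blob325a (d : ℕ) (α : ℝ) : ((blob325a hn).holder (1 + α)).deg d = -(d : ℝ) + 3 + α := by
  rw [(blob325a hn).deg_holder]
  show ((g325a nbar hn).deg d : ℝ) + (1 + α) = _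
  rw [g325a_deg]
  push_cast
  ring

/-- Honest scope of the instance: (3.25)₁ (D = −d + 2) is a "degree 0" blob exactly in d = 2; in d = 3 it is the D = −1 case of
(3.26)–(3.30), not one of the *"other primitively divergent graphs"* of (3.31). [cite: Balaban1983Higgs3, (3.25) p.439] -/
theorem g325a_degZero_iff (d : ℕ) : (g325a nbar hn).deg d = 0 ↔ d = 2 := by
  rw [g325a_deg, sub_eq_zero]
  constructor
  · intro h; exact_mod_cast h.symm
  · rintro rfl; norm_num

/-! ### The p19 count datum of (3.25)₁ DERIVED from the drawn graph (p26's `countsOf`) -/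

/-- The enumeration of the two φ′-lines of (3.25)₁: line `l` runs from the φ′-leg `l` of `x = 0` to the φ′-leg `1 − l` of `x′ = 1`
(line `0` through the differentiated leg of x, line `1` through the differentiated leg of x′ — `B3Eq330Members.δ325a`).
[cite: Balaban1983Higgs3, (3.25) p.439] -/
def fst325 : Fin 2 → Leg kind36 := fun l => sLeg 0 l

/-- second endpoints of the two lines of (3.25)₁. [cite: Balaban1983Higgs3, (3.25) p.439] -/
def snd325 : Fin 2 → Leg kind36 := fun l => sLeg 1 l.rev

/-- The four properties of an enumeration, DECIDED on the closed form: the listed legs are paired, every line is listed once,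
every vertex is an endpoint. [cite: Balaban1983Higgs3, (2.16) p.428] -/
theorem enum325_props :
    (∀ l : Fin 2, other325 (fst325 l) = some (snd325 l)) ∧
    (∀ x y : Leg kind36, other325 x = some y →
      ∃ l : Fin 2, (fst325 l = x ∧ snd325 l = y) ∨ (fst325 l = y ∧ snd325 l = x)) ∧
    (∀ l l' : Fin 2, (fst325 l = fst325 l' ∨ fst325 l = snd325 l') → l = l') ∧
    (∀ v : Fin 2, ∃ l : Fin 2, (fst325 l).1 = v ∨ (snd325 l).1 = v) := by
  refine ⟨by decide, by decide, by decide, by decide⟩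

/-- **The lines of (3.25)₁ enumerated as in `B3Eq330Members.graph325a`** (both from x to x′; p18's `g325a.other` is `other325`
definitionally). [cite: Balaban1983Higgs3, (3.25) p.439] -/
def enum325a : LineEnum (g325a nbar hn) 2 where
  fst := fst325
  snd := snd325
  pair l := by rw [g325a_other]; exact enum325_props.1 l
  cover x y h := enum325_props.2.1 x y (by rwa [g325a_other] at h)
  nodup := enum325_props.2.2.1
  touches := enum325_props.2.2.2

/-- **Line kinds are visible**: both enumerated lines of (3.25)₁ are SCALAR (φ′, straight) lines; line `0` starts at the
differentiated leg of x and ends at the undifferentiated leg of x′, line `1` the other way round.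
[cite: Balaban1983Higgs3, (1.17) p.415] -/
theorem enum325a_kinds :
    (∀ l : Fin 2, ((enum325a hn).fst l).2.isLeft = true ∧ ((enum325a hn).snd l).2.isLeft = true) ∧
      (enum325a hn).fst 0 = sLeg 0 0 ∧ (enum325a hn).snd 0 = sLeg 1 1 ∧
        (enum325a hn).fst 1 = sLeg 0 1 ∧ (enum325a hn).snd 1 = sLeg 1 0 := by
  show (∀ l : Fin 2, (fst325 l).2.isLeft = true ∧ (snd325 l).2.isLeft = true) ∧
    fst325 0 = sLeg 0 0 ∧ snd325 0 = sLeg 1 1 ∧ fst325 1 = sLeg 0 1 ∧ snd325 1 = sLeg 1 0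
  decide

/-- both lines run from `x = 0` to `x′ = 1`. [cite: Balaban1983Higgs3, (3.25) p.439] -/
theorem enum325_endpoints (l : Fin 2) : (fst325 l).1 = 0 ∧ (snd325 l).1 = 1 := ⟨rfl, rfl⟩

/-- kernel: equality of count data from equality of their data fields. [folklore] -/
private theorem counts_ext {V : Type} [Fintype V] [DecidableEq V] {m : ℕ} {C C' : Counts V m} (h1 : C.src = C'.src)
    (h2 : C.tgt = C'.tgt) (h3 : C.diffOn = C'.diffOn) (h4 : C.vecLegAvg = C'.vecLegAvg) (h5 : C.etaPow = C'.etaPow)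
    (h6 : C.d = C'.d) (h7 : C.L = C'.L) (h8 : C.δ₁ = C'.δ₁) : C = C' := by
  cases C; cases C'
  simp only at h1 h2 h3 h4 h5 h6 h7 h8
  subst h1 h2 h3 h4 h5 h6 h7 h8
  rfl

/-- p18's `g325a` carries p26's differentiations `legDiffs36` (`1` on the leg `0` of each vertex (1.8)) and no averaged legs.
[cite: Balaban1983Higgs3, (2.1) p.422] -/
theorem legDiffs_g325a (x : Leg kind36) : legDiffs (g325a nbar hn) x = legDiffs36 x ∧ legAvg (g325a nbar hn) x = 0 := by
  obtain ⟨i, j | j⟩ := x <;> exact ⟨rfl, rfl⟩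

/-- The pattern read off the drawn graph IS `δ325a` (the vertex `v` differentiates the line `v`: line `0` through the arrowed leg
of x, line `1` through the arrowed leg of x′) — DECIDED. [cite: Balaban1983Higgs3, (2.14) p.427] -/
theorem pattern325 : ∀ v l : Fin 2,
    (if (fst325 l).1 = v then legDiffs36 (fst325 l) else 0) + (if (snd325 l).1 = v then legDiffs36 (snd325 l) else 0) =
      δ325a v l := by
  decide

/-- **THE COUNT DATUM `graph325a` OF `B3Eq330Members` IS THE ONE READ OFF THE DRAWN GRAPH (3.25)₁** (`d = 3`, `L = 2`, `δ₁ = 1`):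
endpoints x → x′ for both φ′-lines, the pattern `δ325a`, no averaged legs, proper η-power `0` of (1.8)_{1,0}.
[cite: Balaban1983Higgs3, (3.25) p.439, (2.14) p.427] -/
theorem countsOf_g325a :
    countsOf (g325a nbar hn) (enum325a hn) 3 2 1 (by norm_num) le_rfl one_pos = graph325a := by
  refine counts_ext ?_ ?_ ?_ ?_ ?_ rfl rfl rfl
  · funext l
    show (fst325 l).1 = 0
    exact (enum325_endpoints l).1
  · funext l
    show (snd325 l).1 = 1
    exact (enum325_endpoints l).2
  · funext v l
    show (if (fst325 l).1 = v then legDiffs (g325a nbar hn) (fst325 l) else 0) +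
        (if (snd325 l).1 = v then legDiffs (g325a nbar hn) (snd325 l) else 0) = δ325a v l
    rw [(legDiffs_g325a hn _).1, (legDiffs_g325a hn _).1]
    exact pattern325 v l
  · funext v l
    show (if (fst325 l).1 = v then legAvg (g325a nbar hn) (fst325 l) else 0) +
        (if (snd325 l).1 = v then legAvg (g325a nbar hn) (snd325 l) else 0) = 0
    rw [(legDiffs_g325a hn _).2, (legDiffs_g325a hn _).2]
    simp
  · funext v
    show ((VertexKind.v18 1 0).etaCount 3 - 3).toNat = 0
    decide

/-- Each one-line block of the derived datum (either φ′-line shrunk first) has degree `1` (> 0: (3.25)₁ contains no subgraph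
(2.4)) — `B3Eq330Members.degQ_one_graph325a` transported. [cite: Balaban1983Higgs3, (3.25) p.439] -/
theorem degQ_one_countsOf_g325a (σ : Equiv.Perm (Fin 2)) :
    degQ (relabelCounts (countsOf (g325a nbar hn) (enum325a hn) 3 2 1 (by norm_num) le_rfl one_pos) σ) 1 (0 : Fin 2) = 1 := by
  rw [countsOf_g325a]; exact degQ_one_graph325a σ

/-- **"(D = −d + 2)"** (p. 439) for the derived datum at `d = 3`: the whole drawn graph has degree `−1` along either ordering
(`degQ_two_graph325a`) — equal to p18's catalogue degree of the drawing (`g325a_deg 3`). [cite: Balaban1983Higgs3, (3.25) p.439] -/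
theorem degQ_two_countsOf_g325a (σ : Equiv.Perm (Fin 2)) :
    degQ (relabelCounts (countsOf (g325a nbar hn) (enum325a hn) 3 2 1 (by norm_num) le_rfl one_pos) σ) 2 (0 : Fin 2) = -1 ∧
      (g325a nbar hn).deg 3 = -1 := by
  refine ⟨by rw [countsOf_g325a]; exact degQ_two_graph325a σ, ?_⟩
  rw [g325a_deg]; norm_num

end

end Counting

/-! ## §3 The dictionary: the three pictures of (3.32) ↦ the three terms of (3.31) -/

section Dictionary

open B3Prop1 B3Cor23Concrete B3Sect3LowestOrderGraphs B3Eq37Pictures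
open LatticeFieldCalculus B3Sect3ScalarSelfEnergy B3Sect3VectorSelfEnergy

noncomputable section

variable {nbar : ℕ} {P : Params} {j : ℕ}

/-- **The expression of a localized picture with two chosen external VECTOR legs** `e` (field g·A_μ) and `e′` (field g′·A′_{μ′})
and a kernel `K(xs)_{μμ′}` depending on the positions of all vertices: Σ over all vertex positions `xs : vertices → T^{(j)}_η` of
η^{(#vertices)·d}·Σ_{μ,μ′} g(xs(loc e))A_μ(xs(loc e))·K(xs)_{μμ′}·g′(xs(loc e′))A′_{μ′}(xs(loc e′)) — each leg's field evaluated AT ITS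
LOCALIZATION VERTEX (p. 417; p26's `LocPicture.amp` for vector legs, A_μ(x) = A ⟨x, μ⟩ as in r15's `pairSum`).  The kernel (product
of the propagators of the blob's lines and its vertex factors) is supplied by the caller. [cite: Balaban1983Higgs3, p.417] -/
def ampV (Pic : LocPicture nbar) (e e' : Leg Pic.G.kind) (η : ℝ) (K : (Fin Pic.G.nV → Site P j) → Fin P.d → Fin P.d → ℝ)
    (g g' : SiteField P j ℝ) (A A' : VecField P j ℝ) : ℝ :=
  ∑ xs : Fin Pic.G.nV → Site P j, η ^ (Pic.G.nV * P.d) * ∑ μ : Fin P.d, ∑ μ' : Fin P.d,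
    g (xs (Pic.loc e)) * A ⟨xs (Pic.loc e), μ⟩ * K xs μ μ' * (g' (xs (Pic.loc e')) * A' ⟨xs (Pic.loc e'), μ'⟩)

/-- **The expression of a Hölder-decorated picture** with the undecorated external vector leg `e` (field g·A_μ): as `ampV`, the
decorated leg reading |x_base − x_w|^α·(g′(x_w)A′_{μ′}(x_w) − g′(x_base)A′_{μ′}(x_base))/|x_base − x_w|^α with x_w = xs(loc wleg),
x_base = xs(base), |·| = η·(sup torus distance in lattice steps, `LatticeFieldCalculus.supDist`) as in r15's `eq331` (the weight
|·|^α is the "+α" of the blob, the quotient the "−α" of the leg). [cite: Balaban1983Higgs3, (3.31) p.442] -/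
def ampH (H : HolderPicture nbar) (e : Leg H.G.kind) (η : ℝ) (K : (Fin H.G.nV → Site P j) → Fin P.d → Fin P.d → ℝ)
    (g g' : SiteField P j ℝ) (A A' : VecField P j ℝ) : ℝ :=
  ∑ xs : Fin H.G.nV → Site P j, η ^ (H.G.nV * P.d) * ∑ μ : Fin P.d, ∑ μ' : Fin P.d,
    g (xs (H.loc e)) * A ⟨xs (H.loc e), μ⟩ * K xs μ μ' *
      ((η * supDist (xs H.base) (xs (H.loc H.wleg))) ^ H.α *
        ((g' (xs (H.loc H.wleg)) * A' ⟨xs (H.loc H.wleg), μ'⟩ - g' (xs H.base) * A' ⟨xs H.base, μ'⟩) /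
          (η * supDist (xs H.base) (xs (H.loc H.wleg))) ^ H.α))

/-- **Π_{μμ′}(x,x′), the kernel of the blob** ((3.31): *"Π_{μμ′}(x,x′)"*): the position kernel summed over the positions of the
INTERNAL vertices, the two external vertices pinned at x = xs(`e.1`), x′ = xs(`e′.1`), with the volume element η^{(#vertices − 2)·d}
of the internal vertices. [cite: Balaban1983Higgs3, (3.31) p.442] -/
def VBlob.redKernel (B : VBlob nbar) (η : ℝ) (K : (Fin B.G.nV → Site P j) → Fin P.d → Fin P.d → ℝ) :
    Fin P.d → Fin P.d → Kernel P j :=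
  fun μ μ' x x' => ∑ xs : Fin B.G.nV → Site P j,
    if xs B.e.1 = x ∧ xs B.e'.1 = x' then η ^ ((B.G.nV - 2) * P.d) * K xs μ μ' else 0

/-- **The coefficient of the local vertex ∿×∿**: c_{μμ′}(x) = Σ_{x′} η^d Π_{μμ′}(x,x′) (the round bracket of the second term of
(3.31), *"with the summation over x′"* of p. 417). [cite: Balaban1983Higgs3, (3.31) p.442] -/
def VBlob.vertexCoeff (B : VBlob nbar) (η : ℝ) (K : (Fin B.G.nV → Site P j) → Fin P.d → Fin P.d → ℝ) (μ μ' : Fin P.d)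
    (x : Site P j) : ℝ :=
  ∑ x' : Site P j, η ^ P.d * B.redKernel η K μ μ' x x'

/-- kernel: a sum over all vertex positions, organized by the positions of two chosen vertices. [folklore] -/
private theorem sum_pin₂ {V S M : Type*} [Fintype V] [DecidableEq V] [Fintype S] [DecidableEq S] [AddCommMonoid M]
    (v₁ v₂ : V) (f : (V → S) → M) :
    ∑ xs : V → S, f xs = ∑ x : S, ∑ x' : S, ∑ xs : V → S, if xs v₁ = x ∧ xs v₂ = x' then f xs else 0 := by
  have key : ∀ xs : V → S, (∑ x : S, ∑ x' : S, if xs v₁ = x ∧ xs v₂ = x' then f xs else 0) = f xs := by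
    intro xs
    rw [Finset.sum_eq_single (xs v₁), Finset.sum_eq_single (xs v₂), if_pos ⟨rfl, rfl⟩]
    · intro x' _ hne
      exact if_neg fun h => hne h.2.symm
    · intro h
      exact absurd (Finset.mem_univ _) h
    · intro x _ hne
      exact Finset.sum_eq_zero fun x' _ => if_neg fun h => hne h.1.symm
    · intro h
      exact absurd (Finset.mem_univ _) h
  calc ∑ xs : V → S, f xs
      = ∑ xs : V → S, ∑ x : S, ∑ x' : S, if xs v₁ = x ∧ xs v₂ = x' then f xs else 0 :=
        Finset.sum_congr rfl fun xs _ => (key xs).symm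
    _ = ∑ x : S, ∑ xs : V → S, ∑ x' : S, if xs v₁ = x ∧ xs v₂ = x' then f xs else 0 := Finset.sum_comm
    _ = ∑ x : S, ∑ x' : S, ∑ xs : V → S, if xs v₁ = x ∧ xs v₂ = x' then f xs else 0 :=
        Finset.sum_congr rfl fun _ _ => Finset.sum_comm

/-- **The master dictionary lemma**: with the leg of A_μ read at x = xs(`e.1`) and a second leg `F_{μ′}(x,x′)` read at the two
external vertices, the sum over all vertex positions IS r15's two-leg pairing `pairSum` (Σ_{x,x′}η^{2d}Σ_{μμ′} gA_μ(x)Π_{μμ′}(x,x′)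
F_{μ′}(x,x′)) with the blob's kernel Π = `redKernel`. [cite: Balaban1983Higgs3, (3.31) p.442] -/
theorem VBlob.sum_pair (B : VBlob nbar) (η : ℝ) (K : (Fin B.G.nV → Site P j) → Fin P.d → Fin P.d → ℝ)
    (g : SiteField P j ℝ) (A : VecField P j ℝ) (F : Fin P.d → Site P j → Site P j → ℝ) :
    ∑ xs : Fin B.G.nV → Site P j, η ^ (B.G.nV * P.d) * ∑ μ : Fin P.d, ∑ μ' : Fin P.d,
        g (xs B.e.1) * A ⟨xs B.e.1, μ⟩ * K xs μ μ' * F μ' (xs B.e.1) (xs B.e'.1) =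
      pairSum η (B.redKernel η K) g A F := by
  have hn : B.G.nV * P.d = 2 * P.d + (B.G.nV - 2) * P.d := by
    rw [← Nat.add_mul, Nat.add_sub_cancel' B.two_le_nV]
  rw [sum_pin₂ B.e.1 B.e'.1]
  unfold pairSum VBlob.redKernel
  refine Finset.sum_congr rfl fun x _ => Finset.sum_congr rfl fun x' _ => ?_
  have hl : ∀ xs : Fin B.G.nV → Site P j,
      (if xs B.e.1 = x ∧ xs B.e'.1 = x' then
          η ^ (B.G.nV * P.d) * ∑ μ : Fin P.d, ∑ μ' : Fin P.d,
            g (xs B.e.1) * A ⟨xs B.e.1, μ⟩ * K xs μ μ' * F μ' (xs B.e.1) (xs B.e'.1)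
        else 0) =
        ∑ μ : Fin P.d, ∑ μ' : Fin P.d, η ^ (2 * P.d) * (g x * A ⟨x, μ⟩ *
          ((if xs B.e.1 = x ∧ xs B.e'.1 = x' then η ^ ((B.G.nV - 2) * P.d) * K xs μ μ' else 0) * F μ' x x')) := by
    intro xs
    split_ifs with h
    · rw [h.1, h.2, hn, pow_add, Finset.mul_sum]
      refine Finset.sum_congr rfl fun μ _ => ?_
      rw [Finset.mul_sum]
      refine Finset.sum_congr rfl fun μ' _ => ?_
      ring
    · simp
  rw [Finset.sum_congr rfl fun xs _ => hl xs]
  simp only [Finset.mul_sum, Finset.sum_mul]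
  rw [Finset.sum_comm]
  refine Finset.sum_congr rfl fun μ _ => ?_
  rw [Finset.sum_comm]
  refine Finset.sum_congr rfl fun μ' _ => Finset.sum_congr rfl fun xs _ => ?_
  ring

/-- **LHS of (3.32) ↦ the left side of (3.31)**: Σ_{x,x′}η^{2d}Σ_{μμ′} g(x)A_μ(x)Π_{μμ′}(x,x′)g′(x′)A′_{μ′}(x′) (r15's `pairSum η Π g
A (legFar g′ A′)`). [cite: Balaban1983Higgs3, (3.31) p.442] -/
theorem ampV_blob (B : VBlob nbar) (η : ℝ) (K : (Fin B.G.nV → Site P j) → Fin P.d → Fin P.d → ℝ)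
    (g g' : SiteField P j ℝ) (A A' : VecField P j ℝ) :
    ampV B.blob B.e B.e' η K g g' A A' = pairSum η (B.redKernel η K) g A (legFar g' A') := by
  unfold ampV
  exact B.sum_pair η K g A (legFar g' A')

/-- **RHS₂ of (3.32) ↦** Σ_{x,x′}η^{2d}Σ_{μμ′} g(x)A_μ(x)Π_{μμ′}(x,x′)g′(x)A′_{μ′}(x) (both legs at x; r15's `pairSum η Π g A (legNear
g′ A′)`) … [cite: Balaban1983Higgs3, (3.31) p.442] -/
theorem ampV_vertex (B : VBlob nbar) (η : ℝ) (K : (Fin B.G.nV → Site P j) → Fin P.d → Fin P.d → ℝ)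
    (g g' : SiteField P j ℝ) (A A' : VecField P j ℝ) :
    ampV B.vertex B.e B.e' η K g g' A A' = pairSum η (B.redKernel η K) g A (legNear g' A') := by
  unfold ampV
  rw [B.vertex_loc_e, B.vertex_loc_e']
  exact B.sum_pair η K g A (legNear g' A')

/-- … **= the second term of (3.31)**, *"with the summation over x′"*: Σ_xη^dΣ_{μμ′} g(x)A_μ(x)·c_{μμ′}(x)·g′(x)A′_{μ′}(x) with the
vertex coefficient c_{μμ′}(x) = Σ_{x′}η^dΠ_{μμ′}(x,x′) (r15's `pairSum_local`). [cite: Balaban1983Higgs3, (3.31) p.442] -/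
theorem ampV_vertex_resummed (B : VBlob nbar) (η : ℝ) (K : (Fin B.G.nV → Site P j) → Fin P.d → Fin P.d → ℝ)
    (g g' : SiteField P j ℝ) (A A' : VecField P j ℝ) :
    ampV B.vertex B.e B.e' η K g g' A A' =
      ∑ x : Site P j, η ^ P.d * ∑ μ : Fin P.d, ∑ μ' : Fin P.d,
        g x * A ⟨x, μ⟩ * B.vertexCoeff η K μ μ' x * (g' x * A' ⟨x, μ'⟩) := by
  rw [ampV_vertex]
  exact pairSum_local η (B.redKernel η K) g A (fun μ' x => g' x * A' ⟨x, μ'⟩)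

/-- **RHS₁ of (3.32) ↦ the first term of (3.31)**: Σ_{x,x′}η^{2d}Σ_{μμ′} g(x)A_μ(x)Π_{μμ′}(x,x′)|x′−x|^α
(g′(x′)A′_{μ′}(x′) − g′(x)A′_{μ′}(x))/|x′−x|^α. [cite: Balaban1983Higgs3, (3.31) p.442] -/
theorem ampH_holder (B : VBlob nbar) (α η : ℝ) (K : (Fin B.G.nV → Site P j) → Fin P.d → Fin P.d → ℝ)
    (g g' : SiteField P j ℝ) (A A' : VecField P j ℝ) :
    ampH (B.holder α) B.e η K g g' A A' =
      pairSum η (B.redKernel η K) g A (fun μ' x x' =>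
        (η * supDist x x') ^ α * ((g' x' * A' ⟨x', μ'⟩ - g' x * A' ⟨x, μ'⟩) / (η * supDist x x') ^ α)) := by
  unfold ampH
  exact B.sum_pair η K g A fun μ' x x' =>
    (η * supDist x x') ^ α * ((g' x' * A' ⟨x', μ'⟩ - g' x * A' ⟨x, μ'⟩) / (η * supDist x x') ^ α)

/-- **(3.32) IS (3.31) through the dictionary** — *"we can represent graphically the equality (3.31) in the form (3.32)"*: for
every blob, every kernel, η > 0 and every real α, [∿◯∿] = [∿(◯ +α)∿ −α] + [∿×∿] at the level of expressions, by r15's PROVED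
`B3Sect3VectorSelfEnergy.eq331`. [cite: Balaban1983Higgs3, (3.32) p.442] -/
theorem eq332 (B : VBlob nbar) (η α : ℝ) (hη : 0 < η) (K : (Fin B.G.nV → Site P j) → Fin P.d → Fin P.d → ℝ)
    (g g' : SiteField P j ℝ) (A A' : VecField P j ℝ) :
    ampV B.blob B.e B.e' η K g g' A A' =
      ampH (B.holder α) B.e η K g g' A A' + ampV B.vertex B.e B.e' η K g g' A A' := by
  rw [ampV_blob, ampH_holder, ampV_vertex_resummed]
  exact eq331 η α hη (B.redKernel η K) g g' A A'

/-- the same for the recorded triple `pic332`. [cite: Balaban1983Higgs3, (3.32) p.442] -/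
theorem eq332_pic (B : VBlob nbar) (η α : ℝ) (hη : 0 < η) (K : (Fin B.G.nV → Site P j) → Fin P.d → Fin P.d → ℝ)
    (g g' : SiteField P j ℝ) (A A' : VecField P j ℝ) :
    ampV (pic332 B α).lhs B.e B.e' η K g g' A A' =
      ampH (pic332 B α).holderTerm B.e η K g g' A A' + ampV (pic332 B α).localTerm B.e B.e' η K g g' A A' :=
  eq332 B η α hη K g g' A A'

/-! ### The instance (3.25)₁: two vertices, the kernel of (3.26) -/

/-- kernel: a sum over the positions of two vertices is a double sum. [folklore] -/
private theorem sum_arrow_fin_two {α M : Type*} [Fintype α] [AddCommMonoid M] (f : (Fin 2 → α) → M) :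
    ∑ xs : Fin 2 → α, f xs = ∑ a : α, ∑ b : α, f ![a, b] := by
  rw [← (finTwoArrowEquiv α).symm.sum_comp f, Fintype.sum_prod_type]
  rfl

/-- A two-point kernel with direction indices, K_{μμ′}(x,x′), as a function of the positions of the two vertices `x = xs 0`,
`x′ = xs 1` (p26's `kernel2` for vector lines). [cite: Balaban1983Higgs3, (3.26) p.440] -/
def kernelV2 (Kr : Fin P.d → Fin P.d → Kernel P j) (xs : Fin 2 → Site P j) (μ μ' : Fin P.d) : ℝ := Kr μ μ' (xs 0) (xs 1)

variable (hn : 1 ≤ nbar)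

/-- For the two-vertex blob (3.25)₁ there is no internal vertex to sum: Π_{μμ′}(x,x′) = K_{μμ′}(x,x′).
[cite: Balaban1983Higgs3, (3.26) p.440] -/
theorem redKernel_blob325a (η : ℝ) (Kr : Fin P.d → Fin P.d → Kernel P j) :
    (blob325a hn).redKernel η (kernelV2 Kr) = Kr := by
  funext μ μ' x x'
  unfold VBlob.redKernel kernelV2
  show ∑ xs : Fin 2 → Site P j,
      (if xs 0 = x ∧ xs 1 = x' then η ^ ((2 - 2) * P.d) * Kr μ μ' (xs 0) (xs 1) else 0) = Kr μ μ' x x'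
  rw [sum_arrow_fin_two]
  simp only [Matrix.cons_val_zero, Matrix.cons_val_one, Nat.sub_self, zero_mul, pow_zero, one_mul]
  rw [Finset.sum_eq_single x, Finset.sum_eq_single x', if_pos ⟨rfl, rfl⟩]
  · intro b _ hb
    exact if_neg fun h => hb h.2
  · intro h
    exact absurd (Finset.mem_univ _) h
  · intro a _ ha
    exact Finset.sum_eq_zero fun b _ => if_neg fun h => ha h.1
  · intro h
    exact absurd (Finset.mem_univ _) h

/-- **(3.25)₁ ↦ (3.26)**: with r15's kernel `kerA` of its two lines (tr q²(G^η_{(j)}(0)∂^{η*}_{μ′})(x,x′)(G^η_{(j′)}(0)∂^{η*}_μ)(x′,x),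
the differentiated legs at opposite vertices as drawn) the natural picture of (3.25)₁ reads as the first graph term T₁ of the
left side of (3.26) (`pairSum η kerA g A (legFar g′ A′)`, cf. r15's `lhs326 = −T₁ + T₂ − T₃ − T₄`), and its p. 417-localization
∿×∿ as the first term T₁′ of the square bracket (`legNear`, cf. `bracket326`) — the pictures of (3.30), left side and last vertex.
[cite: Balaban1983Higgs3, (3.26) p.440] -/
theorem amp_g325a_T1 (η τ : ℝ) (Gj Gj' : Kernel P j) (g g' : SiteField P j ℝ) (A A' : VecField P j ℝ) :
    ampV (blob325a hn).blob (vLeg 0) (vLeg 1) η (kernelV2 (kerA η τ Gj Gj')) g g' A A' =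
        pairSum η (kerA η τ Gj Gj') g A (legFar g' A') ∧
      ampV (blob325a hn).vertex (vLeg 0) (vLeg 1) η (kernelV2 (kerA η τ Gj Gj')) g g' A A' =
        pairSum η (kerA η τ Gj Gj') g A (legNear g' A') := by
  have h1 := ampV_blob (blob325a hn) η (kernelV2 (kerA η τ Gj Gj')) g g' A A'
  have h2 := ampV_vertex (blob325a hn) η (kernelV2 (kerA η τ Gj Gj')) g g' A A'
  rw [redKernel_blob325a] at h1 h2
  exact ⟨h1, h2⟩

/-- … and (3.32)/(3.31) for the instance with any two-line kernel K: T₁-shaped term = Hölder term + local term (r15's `eq331` with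
Π = K). [cite: Balaban1983Higgs3, (3.31) p.442] -/
theorem eq332_blob325a (η α : ℝ) (hη : 0 < η) (Kr : Fin P.d → Fin P.d → Kernel P j) (g g' : SiteField P j ℝ)
    (A A' : VecField P j ℝ) :
    pairSum η Kr g A (legFar g' A') =
      ampH ((blob325a hn).holder α) (vLeg 0) η (kernelV2 Kr) g g' A A' +
        ampV (blob325a hn).vertex (vLeg 0) (vLeg 1) η (kernelV2 Kr) g g' A A' := by
  have h := eq332 (blob325a hn) η α hη (kernelV2 Kr) g g' A A'
  rw [ampV_blob, redKernel_blob325a] at h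
  exact h

end

end Dictionary

end Literature.MathematicalPhysics.QuantumFieldTheory.Balaban1983to89.B3Eq332Pictures
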